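import Mathlib
import Literature.Analysis.FluidPDE.Tao2016AveragedNS.ShiftSetCascadeFlows
import Summits.NavierStokesRegularity.NavierStokesRegularity.Theorems.TaoLadderRungTwoFlatCertificateGlueFlowStepOn
import HarnessLib

/-!
# Certificate glue on a shift set `𝕊`, XXV-f: THE CHECKER'S GRÖNWALL ALLOWANCE — an exact rational upper bound of `exp` (Taylor
  bound with argument halving) and the test `gronwallBound 0 (2bR) δ h ≤ A` (hypothesis `hA` of glue XIV-c / XIX-c / XIX-e)
  (helper for items stmt-NavierStokesRegularity-22987 `FlatGapCertificatesV2` (crux K_A♭ of route TaoLadderRungTwoFlat) and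
  stmt-24295 K_A₂(64); cell harvest/h2-tao-ladder, p1 g15; CHECKER-SPEC-v3 §3 (ii) C11)

`expUpperQ y n = Σ_{m<n} y^m/m! + y^n (n+1)/(n!·n)` bounds `exp y` for `0 ≤ y ≤ 1` (Mathlib `Real.exp_bound'`); `expUpperHalvedQ y k n =
(expUpperQ (y/2^k) n)^(2^k)` bounds `exp y` for `0 ≤ y ≤ 2^k`. `checkGronwall b R δ h A k n` tests `δ/(2bR) · (expUpperHalvedQ (2bRh) k n − 1) ≤ A`
with its side conditions; `gronwall_of_check` concludes `gronwallBound 0 (2bR) δ h ≤ A` over `ℝ`.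

HONEST FRAMING: Tao-type MODEL lattices (Tao 2016 §4/§6 vocabulary, shift-set parametrised); arithmetic soundness lemmas — no
certificate data, nothing certified, no stub closed, nothing about the Navier–Stokes equations.
-/

-- the sub-problem namespace repeats the summit name by design (D-0017)
set_option linter.dupNamespace false

namespace Summit.NavierStokesRegularity.NavierStokesRegularity.Theorems

open Finset

namespace CertificateGlueOn

/-- Rational Taylor upper bound of `exp y` on `[0, 1]`: `Σ_{m<n} y^m/m! + y^n (n+1)/(n!·n)`. [folklore] -/
def expUpperQ (y : ℚ) (n : ℕ) : ℚ :=
  (∑ m ∈ Finset.range n, y ^ m / (m.factorial : ℚ)) + y ^ n * ((n : ℚ) + 1) / ((n.factorial : ℚ) * n)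

/-- `exp y ≤ expUpperQ y n` for `0 ≤ y ≤ 1`, `0 < n`. [folklore] -/
theorem exp_le_expUpperQ {y : ℚ} (h0 : 0 ≤ y) (h1 : y ≤ 1) {n : ℕ} (hn : 0 < n) :
    Real.exp (y : ℝ) ≤ (expUpperQ y n : ℝ) := by
  have h := Real.exp_bound' (x := (y : ℝ)) (by exact_mod_cast h0) (by exact_mod_cast h1) hn
  have hc : ((expUpperQ y n : ℚ) : ℝ) = (∑ m ∈ Finset.range n, (y : ℝ) ^ m / (m.factorial : ℝ)) +
      (y : ℝ) ^ n * ((n : ℝ) + 1) / ((n.factorial : ℝ) * n) := by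
    simp only [expUpperQ]; push_cast; rfl
  rw [hc]
  exact h

/-- Upper bound of `exp y` on `[0, 2^k]` by halving: `(expUpperQ (y/2^k) n)^(2^k)`. [folklore] -/
def expUpperHalvedQ (y : ℚ) (k n : ℕ) : ℚ := (expUpperQ (y / 2 ^ k) n) ^ (2 ^ k)

/-- `exp y ≤ expUpperHalvedQ y k n` for `0 ≤ y`, `y/2^k ≤ 1`, `0 < n`. [folklore] -/
theorem exp_le_expUpperHalvedQ {y : ℚ} (h0 : 0 ≤ y) {k n : ℕ} (h1 : y / 2 ^ k ≤ 1) (hn : 0 < n) :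
    Real.exp (y : ℝ) ≤ (expUpperHalvedQ y k n : ℝ) := by
  have hy' : 0 ≤ y / 2 ^ k := by positivity
  have hstep := exp_le_expUpperQ hy' h1 hn
  have hexp : Real.exp (y : ℝ) = Real.exp ((y / 2 ^ k : ℚ) : ℝ) ^ (2 ^ k) := by
    rw [← Real.exp_nat_mul]; congr 1; push_cast; field_simp
  rw [hexp]
  unfold expUpperHalvedQ
  push_cast
  have hcast : Real.exp (((y / 2 ^ k : ℚ) : ℝ)) = Real.exp ((y : ℝ) / 2 ^ k) := by push_cast; rfl
  have hstep' : Real.exp ((y : ℝ) / 2 ^ k) ≤ ((expUpperQ (y / 2 ^ k) n : ℚ) : ℝ) := by rw [← hcast]; exact hstep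
  exact pow_le_pow_left₀ (Real.exp_pos _).le hstep' _

/-- **The Grönwall test**: `K = 2bR > 0`, `δ ≥ 0`, `h ≥ 0`, `Kh ≤ 2^k`, `n > 0`, and `(δ/K)(expUpperHalvedQ (Kh) k n − 1) ≤ A`. [folklore] -/
def checkGronwall (b R δ h A : ℚ) (k n : ℕ) : Bool :=
  decide (0 < 2 * b * R) && decide (0 ≤ δ) && decide (0 ≤ h) && decide (2 * b * R * h / 2 ^ k ≤ 1) && decide (0 < n) &&
    decide (δ / (2 * b * R) * (expUpperHalvedQ (2 * b * R * h) k n - 1) ≤ A)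

/-- **`hA` FROM THE TEST**: `gronwallBound 0 (2bR) δ h ≤ A` over `ℝ` (hypothesis `hA` of glue XIV-c / XIX-c / XIX-e for rational data).
[folklore] -/
theorem gronwall_of_check {b R δ h A : ℚ} {k n : ℕ} (hc : checkGronwall b R δ h A k n = true) :
    gronwallBound 0 (2 * (b : ℝ) * (R : ℝ)) (δ : ℝ) (h : ℝ) ≤ (A : ℝ) := by
  simp only [checkGronwall, Bool.and_eq_true, decide_eq_true_eq] at hc
  obtain ⟨⟨⟨⟨⟨hK, hδ⟩, hh⟩, hk⟩, hn⟩, hA⟩ := hc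
  have hKr : (0 : ℝ) < 2 * (b : ℝ) * (R : ℝ) := by exact_mod_cast hK
  rw [gronwallBound_of_K_ne_0 hKr.ne']
  simp only [zero_mul, zero_add]
  have hexp := exp_le_expUpperHalvedQ (y := 2 * b * R * h) (by positivity) hk hn
  have hA' : ((δ / (2 * b * R) * (expUpperHalvedQ (2 * b * R * h) k n - 1) : ℚ) : ℝ) ≤ (A : ℝ) := by exact_mod_cast hA
  push_cast at hA' hexp
  have hdK : (0 : ℝ) ≤ (δ : ℝ) / (2 * (b : ℝ) * (R : ℝ)) := div_nonneg (by exact_mod_cast hδ) hKr.le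
  calc (δ : ℝ) / (2 * (b : ℝ) * (R : ℝ)) * (Real.exp (2 * (b : ℝ) * (R : ℝ) * (h : ℝ)) - 1)
      ≤ (δ : ℝ) / (2 * (b : ℝ) * (R : ℝ)) * (((expUpperHalvedQ (2 * b * R * h) k n : ℚ) : ℝ) - 1) :=
        mul_le_mul_of_nonneg_left (by linarith) hdK
    _ ≤ (A : ℝ) := hA'

end CertificateGlueOn

end Summit.NavierStokesRegularity.NavierStokesRegularity.Theorems
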